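/-
Copyright (c) 2026. All rights reserved.
Released under Apache 2.0 license as described in the file LICENSE.
-/
import Literature.Probability.FitznerVanDerHofstad2017.NobleBlocksPointwisePrime
import HarnessLib

/-!
# Fitzner–van der Hofstad (2017), §5.1 (5.4): the two degenerate cells of the middle block (WHAT-IF slot payload)

[FvdH17] = R. Fitzner, R. van der Hofstad, *Generalized approach to the non-backtracking lace expansion* /
*Mean-field behavior for nearest-neighbor percolation in `d > 10`*, arXiv:1506.07977v2 (EJP 22 (2017),
paper 43).  Page numbers refer to the arXiv version.

The tables of (5.4) (App. B, pp. 74–76; §5.1 Table p. 47: "`x, y ≠ 0` and `x ≠ v`") are stated away from two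
degenerate cells of the §4.4 `F`-decomposition (v2 p. 42, (4.64)) which the lace coding of this package produces
(b2b-lace packet, HOME DIVERGENCE D77 — a REFEREE QUESTION, not ruled at the time of writing):
`R′ = F‴ ∩ {w_{i+1} = t_i}` (the exit route leaves the backbone exactly at the start of the last sausage: the second
factor of term 1 is evaluated at `x = ` its own base point) and `R ⊂ F″ ∩ {z_i = t_i} ∩ {w_{i+1} ∼ t_i}` (term 2's
class index sits on a one-bond segment).  This module types — and ASSERTS NOTHING OF RECORD ABOUT — the
candidate extra summand for these two cells, as the payload of the slot `X` of
`NobleBlocksPointwisePrime.blockBpt'`: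

* §A. `blockASharp₀ / blockASharp` — the `x = 0` slice Table `A^{c,b}` lacks: the open bubble
  `0 →(j_b) y →(≥1) v` with the entry-class factor `δ_{v,0}` / `2dD(v)` / `1` of Table A, column `b = 0` zero.
* §B. `blockT2Sharp` — term 2's row `(a,1)` letter moved to column `2` at `u ≠ y` (pointwise in the internal vertex).
* §C. The slot pieces `blockXRPrime L c` (cell `(false,c)`), `blockXR L` (cell `(true,0)`), their sum `blockXSharp L`,
  the summed `blockX₂Sharp L` with `Σ_{t,z} blockXSharp = blockX₂Sharp`, and the augmented blocks
  `blockBSharpPt L := blockBFullpt' L (blockXSharp L)`, `blockBSharpFull L := blockBFull' L (blockX₂Sharp L)`,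
  `matBiotaSharp L`.
* §D. Translation invariance.  §E. Bond percolation: `W_d`-covariance, hence `IsCov₆` of `Σ_κ blockBSharpPt`.
* §F. Monotone embeddings of the pieces into `blockBSharpPt` (the shape a class package on `R′` / `R` lands in).

Whether the record uses `X := 0` or `X := blockXSharp` is decided elsewhere; both are instances of the same
dispatch.  Additive (no existing declaration is touched), `d`-generic, nothing cited as a fact.  The rows of §A and
§B are those of the packet's parked draft `NobleBlocksDegenerate` (lit-g17 / carver-g21), re-typed here under
distinct names.

PLACEMENT.  A programme what-if object (not a printed display of [FvdH17]), hence filed under the cell topic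
`Summits/CriticalPhenomena/LaceExpansionHighD/` (b2b-lace LEAN PLACEMENT RULE, REFEREE R491) in
`namespace Summit.CriticalPhenomena.LaceExpansionHighD.NobleBlocks`; typed by seat lean1-g16 (2026-08-19, text otherwise
verbatim), which wrote it against `namespace Literature.Probability.FitznerVanDerHofstad2017.NobleBlocks` (opened here).
-/

noncomputable section

open scoped ENNReal

namespace Summit.CriticalPhenomena.LaceExpansionHighD.NobleBlocks

open Literature.Probability.FitznerVanDerHofstad2017 Literature.Probability.FitznerVanDerHofstad2017.NobleBlocks
open Literature.Probability.LatticeModels Literature.Probability.Percolation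
open Literature.Probability.FitznerVanDerHofstad2017.BlockSummation
open Literature.Barriers.CriticalPhenomena (signedPerm_sub signedPerm_neg)
open scoped BigOperators ENNReal

variable {d : ℕ}

local notation "𝐞" => Literature.Probability.Percolation.stepVec

/-! ### A. The `x = 0` slice of Table `A^{c,b}` -/

/-- **`A♯^{c,b}(0,v,x,y)`** at base point `0`: zero unless `x = 0 ≠ y`; the open bubble `0 →(j_b) y →(≥1) v`
(`j_1 = 1̲`, `j_2 = (≥ 2)`) with the entry-class factor of Table A (`δ_{v,0}` / `2dD(v)` / `1`); column `b = 0` zero.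
This is the slice the printed table excludes ("`x, y ≠ 0`"); what-if object of the packet's referee question D77.
[cite: FitznerVanDerHofstad2017, §5.1 Table "A^{a,b}" (arXiv:1506.07977v2 p. 47) and App. B Table "definition of A^{a,b}(0,v,x,y)" (p. 74); §4.4 (4.64) (p. 42)] -/
def blockASharp₀ (L : Letters d) (c b : Fin 3) (v x y : Site d) : ℝ≥0∞ :=
  kd x 0 * kdc y 0 *
    (match c.val, b.val with
    | _, 0 => 0
    | 0, 1 => kd v 0 * L.B (.eq 1) (.ge 1) y v
    | 0, _ => kd v 0 * L.B (.ge 2) (.ge 1) y v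
    | 1, 1 => twoDD v * L.B (.eq 1) (.ge 1) y v
    | 1, _ => twoDD v * L.B (.ge 2) (.ge 1) y v
    | _, 1 => L.B (.eq 1) (.ge 1) y v
    | _, _ => L.B (.ge 2) (.ge 1) y v)

/-- `A♯^{c,b}` at a general base point. [cite: FitznerVanDerHofstad2017, App. B Table "definition of A^{a,b}(0,v,x,y)" (arXiv:1506.07977v2 p. 74); §4.4 (4.64) (p. 42)] -/
def blockASharp (L : Letters d) (c b : Fin 3) : Site d → Site d → Site d → Site d → ℝ≥0∞ :=
  ofBase (blockASharp₀ L c b)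

/-- `A♯` is translation invariant. [cite: FitznerVanDerHofstad2017, §5.1 "Elements of the bounds" (arXiv:1506.07977v2 p. 49)] -/
theorem isTransInv_blockASharp (L : Letters d) (c b : Fin 3) : IsTransInv (blockASharp L c b) :=
  isTransInv_ofBase _

/-- The `b = 0` column of `A♯` vanishes. [cite: FitznerVanDerHofstad2017, App. B Table "definition of A^{a,b}(0,v,x,y)" (arXiv:1506.07977v2 p. 74)] -/
theorem blockASharp₀_zero (L : Letters d) (c : Fin 3) (v x y : Site d) : blockASharp₀ L c 0 v x y = 0 := by
  rcases c with ⟨_ | _ | _ | n, hc⟩ <;> simp [blockASharp₀]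

/-- The `b = 0` column of `A♯` vanishes (general base point). [cite: FitznerVanDerHofstad2017, App. B Table "definition of A^{a,b}(0,v,x,y)" (arXiv:1506.07977v2 p. 74)] -/
theorem blockASharp_zero (L : Letters d) (c : Fin 3) (u v x y : Site d) : blockASharp L c 0 u v x y = 0 := by
  simp only [blockASharp, ofBase, blockASharp₀_zero]

/-- `A♯` vanishes off its cell `x = u`. [cite: FitznerVanDerHofstad2017, §5.1 Table "A^{a,b}" (arXiv:1506.07977v2 p. 47)] -/
theorem blockASharp_of_ne (L : Letters d) (c b : Fin 3) {u x : Site d} (h : x ≠ u) (v y : Site d) :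
    blockASharp L c b u v x y = 0 := by
  have hx : kd (x - u) (0 : Site d) = 0 := by simp [kd, sub_eq_zero, h]
  simp only [blockASharp, ofBase, blockASharp₀, hx, zero_mul]

/-! ### B. Term 2's row `(a,1)` letter in column `2` -/

/-- **The `R`-slice of term 2, pointwise in the internal vertex `t` (printed `u`)**: for exit class `a' = 2` and
`t ≠ u'`, the row-`(a,1)` letter `A^{ι,a,1}(u;w,w',t)·P^{0}(u'−t,u'−t)`; zero otherwise.  (What-if object of D77:
in `F″` the class pair `(u', w')` has class `2`, while the segment `w' → t` may be a single bond.)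
[cite: FitznerVanDerHofstad2017, §5.1 (5.4) second term (arXiv:1506.07977v2 p. 48); App. B Table "A^{ι,a,b}" (p. 75); §4.4 (4.64) (p. 42)] -/
def blockT2Sharp (L : Letters d) (κ : Fin d × Bool) (a a' : Fin 3) (u w w' t u' : Site d) : ℝ≥0∞ :=
  if a' = 2 then kdc t u' * (blockAiota' L κ a 1 u w w' t * blockPS L 0 (u' - t) (u' - t)) else 0

/-- Off column `2` the `R`-slice vanishes. [cite: FitznerVanDerHofstad2017, §5.1 (5.4) (arXiv:1506.07977v2 p. 48)] -/
theorem blockT2Sharp_of_ne (L : Letters d) (κ : Fin d × Bool) (a : Fin 3) {a' : Fin 3} (h : a' ≠ 2)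
    (u w w' t u' : Site d) : blockT2Sharp L κ a a' u w w' t u' = 0 := by
  simp only [blockT2Sharp, h, if_false]

/-- In column `2` the `R`-slice is the row-`(a,1)` letter times the sausage, off the diagonal `t = u'`.
[cite: FitznerVanDerHofstad2017, §5.1 (5.4) (arXiv:1506.07977v2 p. 48); App. B Table "A^{ι,a,b}" (p. 75)] -/
theorem blockT2Sharp_two (L : Letters d) (κ : Fin d × Bool) (a : Fin 3) (u w w' t u' : Site d) :
    blockT2Sharp L κ a 2 u w w' t u' = kdc t u' * (blockAiota' L κ a 1 u w w' t * blockPS L 0 (u' - t) (u' - t)) := by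
  simp only [blockT2Sharp, if_true]

/-! ### C. The slot payload and the augmented blocks -/

/-- **`R′`-slice at inner class `c`** (cell `(false,c)` of the dispatch): `A'^{κ,a,c,*}(u,w,t,z)·A♯^{c,a'}(t,z,w',u')`
(nonzero only when `w' = t ≠ u'`). [cite: FitznerVanDerHofstad2017, §5.1 (5.4) first term (arXiv:1506.07977v2 p. 48); §4.4 (4.64) (p. 42)] -/
def blockXRPrime (L : Letters d) (c : Fin 3) : DirBlockFamilyPt d := fun κ a a' u w t z w' u' =>
  blockAiotaSt' L κ a c u w t z * blockASharp L c a' t z w' u'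

/-- **`R`-slice** (cell `(true,0)` of the dispatch): `δ_{z,t}·blockT2Sharp`. [cite: FitznerVanDerHofstad2017, §5.1 (5.4) second term (arXiv:1506.07977v2 p. 48); §4.4 (4.64) (p. 42)] -/
def blockXR (L : Letters d) : DirBlockFamilyPt d := fun κ a a' u w t z w' u' =>
  kd z t * blockT2Sharp L κ a a' u w w' t u'

/-- **The slot payload** `X♯ := Σ_c X_{R′,c} + X_R`. [cite: FitznerVanDerHofstad2017, §5.1 (5.4) (arXiv:1506.07977v2 p. 48); §4.4 (4.64) (p. 42)] -/
def blockXSharp (L : Letters d) : DirBlockFamilyPt d := fun κ a a' u w t z w' u' =>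
  (∑ c : Fin 3, blockXRPrime L c κ a a' u w t z w' u') + blockXR L κ a a' u w t z w' u'

/-- **The slot payload summed over the internal pair**: `Σ_c (A'^{κ,a,c,*} ∘ A♯^{c,a'}) + Σ_t blockT2Sharp(t)`.
[cite: FitznerVanDerHofstad2017, §5.1 (5.4) (arXiv:1506.07977v2 p. 48); §4.4 (4.64) (p. 42)] -/
def blockX₂Sharp (L : Letters d) : DirBlockFamily d := fun κ a a' u w w' u' =>
  (∑ c : Fin 3, comp (blockAiotaSt' L κ a c) (blockASharp L c a') u w w' u')
    + ∑' t, blockT2Sharp L κ a a' u w w' t u'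

/-- **The augmented pointwise middle block** `blockBFullpt' L (blockXSharp L)`.
[cite: FitznerVanDerHofstad2017, §5.1 (5.4) (arXiv:1506.07977v2 p. 48); App. B (pp. 74–76); §4.4 (4.64) (p. 42)] -/
def blockBSharpPt (L : Letters d) : DirBlockFamilyPt d := blockBFullpt' L (blockXSharp L)

/-- **The augmented middle block** `blockBFull' L (blockX₂Sharp L)`.
[cite: FitznerVanDerHofstad2017, §5.1 (5.4) (arXiv:1506.07977v2 p. 48); App. B (pp. 74–76); §4.4 (4.64) (p. 42)] -/
def blockBSharpFull (L : Letters d) : DirBlockFamily d := blockBFull' L (blockX₂Sharp L)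

/-- `(B♯)_{a,b} = sup_v Σ_{ι,x,y} B♯^{ι,a,b}(0,v,x,y)`. [cite: FitznerVanDerHofstad2017, §5.1 "Elements of the bounds" (arXiv:1506.07977v2 p. 49)] -/
def matBiotaSharp (L : Letters d) : Matrix (Fin 3) (Fin 3) ℝ≥0∞ := matBiotaFull' L (blockX₂Sharp L)

section Algebra

variable (L : Letters d)

/-- `blockXSharp` unfolded. [cite: FitznerVanDerHofstad2017, §5.1 (5.4) (arXiv:1506.07977v2 p. 48)] -/
theorem blockXSharp_apply (κ : Fin d × Bool) (a a' : Fin 3) (u w t z w' u' : Site d) :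
    blockXSharp L κ a a' u w t z w' u' =
      (∑ c : Fin 3, blockAiotaSt' L κ a c u w t z * blockASharp L c a' t z w' u')
        + kd z t * blockT2Sharp L κ a a' u w w' t u' := rfl

/-- **`Σ_{t,z} blockXSharp = blockX₂Sharp`.** [cite: FitznerVanDerHofstad2017, §5.1 (5.4) (arXiv:1506.07977v2 p. 48)] -/
theorem tsum_tsum_blockXSharp (κ : Fin d × Bool) (a a' : Fin 3) (u w w' u' : Site d) :
    ∑' t, ∑' z, blockXSharp L κ a a' u w t z w' u' = blockX₂Sharp L κ a a' u w w' u' := by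
  have h1 : ∑' t, ∑' z, ∑ c : Fin 3, blockAiotaSt' L κ a c u w t z * blockASharp L c a' t z w' u' =
      ∑ c : Fin 3, comp (blockAiotaSt' L κ a c) (blockASharp L c a') u w w' u' := by
    simp only [comp]; simp_rw [tsum_finsetSum]
  have h2 : ∑' t, ∑' z, kd z t * blockT2Sharp L κ a a' u w w' t u' = ∑' t, blockT2Sharp L κ a a' u w w' t u' :=
    tsum_congr fun t => tsum_kd_mul_const t _
  simp only [blockXSharp, blockXRPrime, blockXR, blockX₂Sharp, ENNReal.tsum_add, h1, h2]

/-- **`Σ_{t,z} blockBSharpPt = blockBSharpFull`.** [cite: FitznerVanDerHofstad2017, §5.1 (5.4) (arXiv:1506.07977v2 p. 48); App. B (p. 76)] -/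
theorem tsum_tsum_blockBSharpPt (κ : Fin d × Bool) (a a' : Fin 3) (u w w' u' : Site d) :
    ∑' t, ∑' z, blockBSharpPt L κ a a' u w t z w' u' = blockBSharpFull L κ a a' u w w' u' :=
  tsum_tsum_blockBFullpt' L (blockXSharp L) (blockX₂Sharp L) (tsum_tsum_blockXSharp L) κ a a' u w w' u'

/-- The block-summation hypothesis `hBpt` for the augmented pair. [cite: FitznerVanDerHofstad2017, §5.1 (5.4) (arXiv:1506.07977v2 p. 48); §6.2.1 (6.49)–(6.51) (pp. 65–67)] -/
theorem blockBSharpPt_hBpt :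
    ∀ κ a a' (u w w' u' : Site d),
      ∑' t, ∑' z, blockBSharpPt L κ a a' u w t z w' u' ≤ blockBSharpFull L κ a a' u w w' u' :=
  fun κ a a' u w w' u' => (tsum_tsum_blockBSharpPt L κ a a' u w w' u').le

/-- Off entry class `0` the augmented pointwise block is the landed pointwise (5.4) (base-`u` `B^{(2)}` piece) plus
the payload. [cite: FitznerVanDerHofstad2017, §5.1 (5.4) (arXiv:1506.07977v2 p. 48); App. B (pp. 75–76)] -/
theorem blockBSharpPt_of_ne {a : Fin 3} (ha : a ≠ 0) (κ : Fin d × Bool) (a' : Fin 3) (u w t z w' u' : Site d) :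
    blockBSharpPt L κ a a' u w t z w' u' =
      blockBpt L (blockBNTpt' L) κ a a' u w t z w' u' + blockXSharp L κ a a' u w t z w' u' := by
  simp only [blockBSharpPt, blockBFullpt', blockBpt'_of_ne L _ _ ha]

end Algebra

/-! ### D. Translation invariance -/

section TransInv

variable (L : Letters d)

/-- `blockT2Sharp` is translation invariant in its five vertices. [cite: FitznerVanDerHofstad2017, §5.1 "Elements of the bounds" (arXiv:1506.07977v2 p. 49)] -/
theorem blockT2Sharp_add (κ : Fin d × Bool) (a a' : Fin 3) (g u w w' t u' : Site d) :
    blockT2Sharp L κ a a' (u + g) (w + g) (w' + g) (t + g) (u' + g) = blockT2Sharp L κ a a' u w w' t u' := by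
  have hAi : blockAiota' L κ a 1 (u + g) (w + g) (w' + g) (t + g) = blockAiota' L κ a 1 u w w' t :=
    isTransInv_blockAiota' L κ a 1 g u w w' t
  have hkdc : kdc (t + g) (u' + g) = kdc t u' := by simp only [kdc, add_left_inj]
  simp only [blockT2Sharp, hAi, hkdc, add_sub_add_right_eq_sub]

/-- The slot payload is translation invariant in all six vertices. [cite: FitznerVanDerHofstad2017, §5.1 "Elements of the bounds" (arXiv:1506.07977v2 p. 49)] -/
theorem isTransInv₆_blockXSharp (κ : Fin d × Bool) (a a' : Fin 3) : IsTransInv₆ (blockXSharp L κ a a') :=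
  fun g u w t z x y => by
  have hAst : ∀ c, blockAiotaSt' L κ a c (u + g) (w + g) (t + g) (z + g) = blockAiotaSt' L κ a c u w t z :=
    fun c => isTransInv_blockAiotaSt' L κ a c g u w t z
  have hA : ∀ c, blockASharp L c a' (t + g) (z + g) (x + g) (y + g) = blockASharp L c a' t z x y :=
    fun c => isTransInv_blockASharp L c a' g t z x y
  have hkd : kd (z + g) (t + g) = kd z t := by simp only [kd, add_left_inj]
  simp only [blockXSharp, blockXRPrime, blockXR, hAst, hA, hkd, blockT2Sharp_add]

/-- The summed slot payload is translation invariant. [cite: FitznerVanDerHofstad2017, §5.1 "Elements of the bounds" (arXiv:1506.07977v2 p. 49)] -/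
theorem isTransInv_blockX₂Sharp (κ : Fin d × Bool) (a a' : Fin 3) : IsTransInv (blockX₂Sharp L κ a a') := by
  have h1 : IsTransInv (fun u v x y => ∑ c : Fin 3, comp (blockAiotaSt' L κ a c) (blockASharp L c a') u v x y) :=
    IsTransInv.finsetSum Finset.univ fun c _ =>
      IsTransInv.comp (isTransInv_blockAiotaSt' L κ a c) (isTransInv_blockASharp L c a')
  have h2 : IsTransInv (fun u v x y => ∑' t, blockT2Sharp L κ a a' u v x t y) := by
    intro g u v x y
    show ∑' t, blockT2Sharp L κ a a' (u + g) (v + g) (x + g) t (y + g) = ∑' t, blockT2Sharp L κ a a' u v x t y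
    rw [← (Equiv.addRight g).tsum_eq]
    exact tsum_congr fun t => blockT2Sharp_add L κ a a' g u v x t y
  exact isTransInv_add h1 h2

/-- The augmented pointwise block is translation invariant in all six vertices. [cite: FitznerVanDerHofstad2017, §5.1 "Elements of the bounds" (arXiv:1506.07977v2 p. 49)] -/
theorem isTransInv₆_blockBSharpPt (κ : Fin d × Bool) (a a' : Fin 3) : IsTransInv₆ (blockBSharpPt L κ a a') :=
  isTransInv₆_blockBFullpt' L (isTransInv₆_blockXSharp L) κ a a'

/-- The augmented block is translation invariant. [cite: FitznerVanDerHofstad2017, §5.1 "Elements of the bounds" (arXiv:1506.07977v2 p. 49)] -/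
theorem isTransInv_blockBSharpFull (ι : Fin d × Bool) (a b : Fin 3) : IsTransInv (blockBSharpFull L ι a b) :=
  isTransInv_blockBFull' L (isTransInv_blockX₂Sharp L) ι a b

end TransInv

/-! ### E. Bond percolation: `W_d`-covariance -/

section SignedPerm

variable (p : unitInterval) (π : Equiv.Perm (Fin d)) (ε : Fin d → ℤˣ) {ρ : Fin d × Bool → Fin d × Bool}

/-- `A♯^{c,b}(0, σv, σx, σy) = A♯^{c,b}(0, v, x, y)`. [cite: FitznerVanDerHofstad2017, App. B Table "definition of A^{a,b}(0,v,x,y)" (arXiv:1506.07977v2 p. 74); §3.5 (p. 32)] -/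
theorem perc_blockASharp₀_signedPerm (c b : Fin 3) (v x y : Site d) :
    blockASharp₀ (Letters.perc d p) c b (Site.signedPerm π ε v) (Site.signedPerm π ε x) (Site.signedPerm π ε y) =
      blockASharp₀ (Letters.perc d p) c b v x y := by
  fin_cases c <;> fin_cases b <;>
    simp only [blockASharp₀, kd_signedPerm_zero, kdc_signedPerm_zero, twoDD_signedPerm, perc_B_signedPerm]

/-- `A♯^{c,b}(σu, σv, σx, σy) = A♯^{c,b}(u, v, x, y)`. [cite: FitznerVanDerHofstad2017, App. B Table "definition of A^{a,b}(0,v,x,y)" (arXiv:1506.07977v2 p. 74); §3.5 (p. 32)] -/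
theorem perc_blockASharp_signedPerm (c b : Fin 3) (u v x y : Site d) :
    blockASharp (Letters.perc d p) c b (Site.signedPerm π ε u) (Site.signedPerm π ε v) (Site.signedPerm π ε x)
      (Site.signedPerm π ε y) = blockASharp (Letters.perc d p) c b u v x y := by
  simp only [blockASharp, ofBase, ← signedPerm_sub, perc_blockASharp₀_signedPerm]

/-- `blockT2Sharp 𝐋 (ρκ) a a' (σ·) = blockT2Sharp 𝐋 κ a a' (·)` when `σ e_κ = e_{ρκ}`.
[cite: FitznerVanDerHofstad2017, App. B Table "A^{ι,a,b}" (arXiv:1506.07977v2 p. 75); §3.5 (p. 32)] -/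
theorem perc_blockT2Sharp_signedPerm (hρ : ∀ κ, Site.signedPerm π ε (𝐞 κ) = 𝐞 (ρ κ)) (κ : Fin d × Bool)
    (a a' : Fin 3) (u w w' t u' : Site d) :
    blockT2Sharp (Letters.perc d p) (ρ κ) a a' (Site.signedPerm π ε u) (Site.signedPerm π ε w)
      (Site.signedPerm π ε w') (Site.signedPerm π ε t) (Site.signedPerm π ε u') =
      blockT2Sharp (Letters.perc d p) κ a a' u w w' t u' := by
  simp only [blockT2Sharp, kdc_signedPerm, perc_blockAiota'_signedPerm p π ε hρ, ← signedPerm_sub,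
    perc_blockPS_signedPerm]

/-- **Slot payload covariance**: `blockXSharp 𝐋 (ρκ) a b (σ·) = blockXSharp 𝐋 κ a b (·)` when `σ e_κ = e_{ρκ}`.
[cite: FitznerVanDerHofstad2017, §5.1 (5.4) (arXiv:1506.07977v2 p. 48); §3.5 (p. 32)] -/
theorem perc_blockXSharp_signedPerm (hρ : ∀ κ, Site.signedPerm π ε (𝐞 κ) = 𝐞 (ρ κ)) (κ : Fin d × Bool)
    (a b : Fin 3) (u w t z w' u' : Site d) :
    blockXSharp (Letters.perc d p) (ρ κ) a b (Site.signedPerm π ε u) (Site.signedPerm π ε w) (Site.signedPerm π ε t)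
      (Site.signedPerm π ε z) (Site.signedPerm π ε w') (Site.signedPerm π ε u') =
      blockXSharp (Letters.perc d p) κ a b u w t z w' u' := by
  simp only [blockXSharp, blockXRPrime, blockXR, perc_blockAiotaSt'_signedPerm p π ε hρ,
    perc_blockASharp_signedPerm p π ε, kd_signedPerm, perc_blockT2Sharp_signedPerm p π ε hρ]

/-- `blockBSharpPt 𝐋 (ρκ) a b (σ·) = blockBSharpPt 𝐋 κ a b (·)` when `σ e_κ = e_{ρκ}`.
[cite: FitznerVanDerHofstad2017, §5.1 (5.4) (arXiv:1506.07977v2 p. 48); App. B (pp. 74–76); §3.5 (p. 32)] -/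
theorem perc_blockBSharpPt_signedPerm (hρ : ∀ κ, Site.signedPerm π ε (𝐞 κ) = 𝐞 (ρ κ)) (κ : Fin d × Bool)
    (a b : Fin 3) (u w t z w' u' : Site d) :
    blockBSharpPt (Letters.perc d p) (ρ κ) a b (Site.signedPerm π ε u) (Site.signedPerm π ε w)
      (Site.signedPerm π ε t) (Site.signedPerm π ε z) (Site.signedPerm π ε w') (Site.signedPerm π ε u') =
      blockBSharpPt (Letters.perc d p) κ a b u w t z w' u' :=
  perc_blockBFullpt'_signedPerm p π ε hρ (perc_blockXSharp_signedPerm p π ε hρ) κ a b u w t z w' u'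

/-- `Σ_κ blockBSharpPt 𝐋 κ a b (σ·) = Σ_κ blockBSharpPt 𝐋 κ a b (·)`.
[cite: FitznerVanDerHofstad2017, §5.1 (5.4) (arXiv:1506.07977v2 p. 48); §3.5 (p. 32)] -/
theorem sum_perc_blockBSharpPt_signedPerm (a b : Fin 3) (u w t z w' u' : Site d) :
    ∑ κ, blockBSharpPt (Letters.perc d p) κ a b (Site.signedPerm π ε u) (Site.signedPerm π ε w)
        (Site.signedPerm π ε t) (Site.signedPerm π ε z) (Site.signedPerm π ε w') (Site.signedPerm π ε u') =
      ∑ κ, blockBSharpPt (Letters.perc d p) κ a b u w t z w' u' :=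
  sum_perc_blockBFullpt'_signedPerm p π ε (fun _ hρ => perc_blockXSharp_signedPerm p π ε hρ) a b u w t z w' u'

end SignedPerm

/-- **`Σ_κ blockBSharpPt 𝐋 κ a b` is `W_d`-covariant in all six vertices** (hypothesis `hBpt` of
`isCov₄_sum_secEo` / `isCov₃_sum_secEc` / `isCov₃_sum_secEoc` for the augmented block).
[cite: FitznerVanDerHofstad2017, §5.1 (5.4) (arXiv:1506.07977v2 p. 48); §3.5 (p. 32)] -/
theorem isCov₆_sum_perc_blockBSharpPt (p : unitInterval) (a b : Fin 3) :
    IsCov₆ (signedPermAddEquivs d) (fun u w t z w' u' => ∑ κ, blockBSharpPt (Letters.perc d p) κ a b u w t z w' u') :=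
  isCov₆_sum_perc_blockBFullpt' p (fun π ε _ hρ => perc_blockXSharp_signedPerm p π ε hρ) a b

/-! ### F. Monotone embeddings (landing shapes for class packages on `R′` and `R`) -/

section Mono

variable (L : Letters d)

/-- The `R′`-slice at inner class `c` sits inside the payload. [cite: FitznerVanDerHofstad2017, §5.1 (5.4) (arXiv:1506.07977v2 p. 48)] -/
theorem blockXRPrime_le_blockXSharp (c : Fin 3) (κ : Fin d × Bool) (a a' : Fin 3) (u w t z w' u' : Site d) :
    blockXRPrime L c κ a a' u w t z w' u' ≤ blockXSharp L κ a a' u w t z w' u' :=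
  le_add_right (Finset.single_le_sum (f := fun c => blockXRPrime L c κ a a' u w t z w' u') (fun _ _ => _root_.zero_le)
    (Finset.mem_univ c))

/-- The `R`-slice sits inside the payload. [cite: FitznerVanDerHofstad2017, §5.1 (5.4) (arXiv:1506.07977v2 p. 48)] -/
theorem blockXR_le_blockXSharp (κ : Fin d × Bool) (a a' : Fin 3) (u w t z w' u' : Site d) :
    blockXR L κ a a' u w t z w' u' ≤ blockXSharp L κ a a' u w t z w' u' :=
  le_add_left le_rfl

/-- The payload sits inside the augmented pointwise block. [cite: FitznerVanDerHofstad2017, §5.1 (5.4) (arXiv:1506.07977v2 p. 48)] -/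
theorem blockXSharp_le_blockBSharpPt (κ : Fin d × Bool) (a a' : Fin 3) (u w t z w' u' : Site d) :
    blockXSharp L κ a a' u w t z w' u' ≤ blockBSharpPt L κ a a' u w t z w' u' :=
  le_add_left le_rfl

/-- **Landing shape on `R′`**: `A'^{κ,a,c,*}(u,w,t,z)·A♯^{c,a'}(t,z,w',u') ≤ blockBSharpPt`.
[cite: FitznerVanDerHofstad2017, §5.1 (5.4) first term (arXiv:1506.07977v2 p. 48); §4.4 (4.64) (p. 42)] -/
theorem mul_blockASharp_le_blockBSharpPt (c : Fin 3) (κ : Fin d × Bool) (a a' : Fin 3) (u w t z w' u' : Site d) :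
    blockAiotaSt' L κ a c u w t z * blockASharp L c a' t z w' u' ≤ blockBSharpPt L κ a a' u w t z w' u' :=
  (blockXRPrime_le_blockXSharp L c κ a a' u w t z w' u').trans (blockXSharp_le_blockBSharpPt L κ a a' u w t z w' u')

/-- **Landing shape on `R`**: `δ_{z,t}·blockT2Sharp ≤ blockBSharpPt`.
[cite: FitznerVanDerHofstad2017, §5.1 (5.4) second term (arXiv:1506.07977v2 p. 48); §4.4 (4.64) (p. 42)] -/
theorem kd_mul_blockT2Sharp_le_blockBSharpPt (κ : Fin d × Bool) (a a' : Fin 3) (u w t z w' u' : Site d) :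
    kd z t * blockT2Sharp L κ a a' u w w' t u' ≤ blockBSharpPt L κ a a' u w t z w' u' :=
  (blockXR_le_blockXSharp L κ a a' u w t z w' u').trans (blockXSharp_le_blockBSharpPt L κ a a' u w t z w' u')

/-- **Landing shape on `R`, column `2`, at the cut-through cell `z = t ≠ u'`**:
`A'^{κ,a,1}(u;w,w',t)·P^{0}(u'−t,u'−t) ≤ blockBSharpPt L κ a 2 u w t t w' u'`.
[cite: FitznerVanDerHofstad2017, §5.1 (5.4) second term (arXiv:1506.07977v2 p. 48); App. B Table "A^{ι,a,b}" (p. 75)] -/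
theorem blockAiota'_one_mul_blockPS_le_blockBSharpPt (κ : Fin d × Bool) (a : Fin 3) {t u' : Site d} (h : t ≠ u')
    (u w w' : Site d) :
    blockAiota' L κ a 1 u w w' t * blockPS L 0 (u' - t) (u' - t) ≤ blockBSharpPt L κ a 2 u w t t w' u' := by
  refine le_trans (le_of_eq ?_) (kd_mul_blockT2Sharp_le_blockBSharpPt L κ a 2 u w t t w' u')
  simp [blockT2Sharp_two, kd, kdc, h]

/-- The landed pointwise (5.4) with the base-`u` `B^{(2)}` piece sits inside the augmented block (so every package
against `blockBFullpt' L 0` is one against `blockBSharpPt L`). [cite: FitznerVanDerHofstad2017, §5.1 (5.4) (arXiv:1506.07977v2 p. 48)] -/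
theorem blockBFullpt'_zero_le_blockBSharpPt (κ : Fin d × Bool) (a a' : Fin 3) (u w t z w' u' : Site d) :
    blockBFullpt' L 0 κ a a' u w t z w' u' ≤ blockBSharpPt L κ a a' u w t z w' u' := by
  simp only [blockBSharpPt, blockBFullpt', blockBpt'_eq_add_X L (blockBNTpt' L) (blockXSharp L)]
  exact le_self_add

end Mono

end Summit.CriticalPhenomena.LaceExpansionHighD.NobleBlocks

end
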